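import Mathlib.Analysis.Fourier.FiniteAbelian.PontryaginDuality
import Mathlib.GroupTheory.QuotientGroup.Basic
import HarnessLib

/-!
# The abelian coset Fredholm alternative (route ConvexRankGates, crux `Capture`, line
`csp-spine-meet-to-join`, support for stub `stub_cosetMeetToJoinAbelian`)

Pure group theory behind the abelian half of Stub 3 of the line.  Data: a finite abelian group
`A` (written additively), CSP variables `Fin nv`, and `m` coset constraints: constraint `j` has a
scope `scope j : Fin (r j) → Fin nv`, a subgroup `H j ≤ A^{r j}` and a representative `c j`, and
is satisfied by `h : Fin nv → A` iff `-c j + h ∘ scope j ∈ H j`.  For a selection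
`v : Fin m → Bool` of constraints let `UNSAT v` say that the selected constraints have no common
solution (an emptiness-of-an-intersection-of-cosets condition — a MEET).

* `abGen scope c j χ = (χ ∘ scope j^*, t ↦ χ (t • c j))` — for a character `χ` of `A^{r j}`
  annihilating `H j`, the pair (pull-back of `χ` to `P = A^{nv}`, the character `t ↦ χ (t • c j)`
  of `ZMod |A|`), an element of `𝒬 = P̂ × (ZMod |A|)̂`;
* `abelianCosetFredholm` — **`UNSAT v ↔ ∃ ω ≠ 0, (0, ω) ∈ ⟨abGen j χ : v j = true, χ ∈ (H j)^⊥⟩`**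
  (a JOIN condition: membership in a generated subgroup).  `←`: along a common solution `h`
  every element `(θ, ω)` of the generated subgroup satisfies `ω = (t ↦ θ (t • h))`.  `→`: in
  `W = ∏_j A^{r j}` the tuple `(c j)_j` lies outside `K = range (h ↦ (h ∘ scope j)_j) + ∏_{v j} H j`
  (`+ ⊤` at unselected `j`), so (`AddChar.exists_apply_ne_zero` on `W ⧸ K`) some character `Ψ`
  of `W` is trivial on `K` and not on `(c j)_j`; its coordinate restrictions `χ j` annihilate the
  `H j`, `∑_j χ j ∘ scope j^* = Ψ ∘ Φ = 0` and `∏_j χ j (c j) = Ψ (c) ≠ 1`;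
* `abEmb` — the injective homomorphism `𝒬 →+ (Option (Fin nv) → Â × (ZMod |A|)̂)` recording a
  character of `P` by its `nv` coordinate restrictions (the small faithful permutation model used
  by the stub file: `|Â × (ZMod |A|)̂| · (nv + 1) = |A|² (nv + 1)` points).

References: folklore (Pontryagin duality for finite abelian groups, as in Mathlib's
`Mathlib/Analysis/Fourier/FiniteAbelian/PontryaginDuality.lean`); the line card
`Cruxes/Capture/Lines/csp-spine-meet-to-join.md`, Stub 3a.
-/

namespace Summit.PneNP.PneNP.Cruxes.Capture.CspSpineMeetToJoin

set_option linter.dupNamespace false -- `Summit.PneNP.PneNP.…`: summit = sub-problem (D-0017)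

open AddChar

/-! ## Characters separate a subgroup from a point outside it -/

section Separation

variable {W : Type*} [AddCommGroup W] [Finite W]

/-- **Separation by characters**: if `x ∉ K` for a subgroup `K` of a finite abelian group `W`,
some complex character of `W` is trivial on `K` and nontrivial at `x`
(`AddChar.exists_apply_ne_zero` in `W ⧸ K`). [folklore] -/
theorem ab_exists_addChar_apply_ne_one (K : AddSubgroup W) {x : W} (hx : x ∉ K) :
    ∃ Ψ : AddChar W ℂ, (∀ k ∈ K, Ψ k = 1) ∧ Ψ x ≠ 1 := by
  have hx' : (x : W ⧸ K) ≠ 0 := by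
    rwa [Ne, QuotientAddGroup.eq_zero_iff]
  obtain ⟨ψ, hψ⟩ := AddChar.exists_apply_ne_zero.2 hx'
  refine ⟨ψ.compAddMonoidHom (QuotientAddGroup.mk' K), fun k hk => ?_, hψ⟩
  rw [AddChar.compAddMonoidHom_apply, QuotientAddGroup.mk'_apply,
    (QuotientAddGroup.eq_zero_iff k).2 hk, map_zero_eq_one]

end Separation

/-- A character sends a finite sum to the product of its values. [folklore] -/
theorem ab_map_sum {W ι : Type*} [AddCommGroup W] (ψ : AddChar W ℂ) (s : Finset ι) (f : ι → W) :
    ψ (∑ i ∈ s, f i) = ∏ i ∈ s, ψ (f i) := by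
  classical
  induction s using Finset.induction_on with
  | empty => simp
  | insert a s ha ih => rw [Finset.sum_insert ha, Finset.prod_insert ha, map_add_eq_mul, ih]

/-! ## The cyclic orbit homomorphism `t ↦ t • w` of `ZMod |A|` -/

section Cyc

variable {A : Type*} [AddCommGroup A] [Fintype A] {ι : Type*}

/-- `|A| • w = 0` in `A^ι`. [folklore] -/
theorem ab_card_nsmul (w : ι → A) : Fintype.card A • w = 0 :=
  funext fun i => by simp

/-- Hence multiples of `w` only depend on the multiplier modulo `|A|`. [folklore] -/
theorem ab_mod_nsmul (n : ℕ) (w : ι → A) : (n % Fintype.card A) • w = n • w := by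
  calc (n % Fintype.card A) • w
      = (n % Fintype.card A) • w + (n / Fintype.card A) • (Fintype.card A • w) := by
        rw [ab_card_nsmul, nsmul_zero, add_zero]
    _ = (n % Fintype.card A + Fintype.card A * (n / Fintype.card A)) • w := by
        rw [add_nsmul, mul_nsmul]
    _ = n • w := by rw [Nat.mod_add_div]

/-- The **cyclic orbit homomorphism** `ZMod |A| →+ A^ι`, `t ↦ t • w` (well defined because
`|A| • w = 0`). [folklore] -/
def abCyc (w : ι → A) : ZMod (Fintype.card A) →+ (ι → A) where
  toFun t := t.val • w
  map_zero' := by rw [ZMod.val_zero, zero_nsmul]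
  map_add' a b := by rw [ZMod.val_add, ab_mod_nsmul, add_nsmul]

/-- `abCyc w t = t.val • w`. [folklore] -/
@[simp] theorem abCyc_apply (w : ι → A) (t : ZMod (Fintype.card A)) : abCyc w t = t.val • w := rfl

/-- `abCyc w 1 = w`. [folklore] -/
@[simp] theorem abCyc_one (w : ι → A) : abCyc w 1 = w := by
  rw [abCyc_apply, ZMod.val_one_eq_one_mod, ab_mod_nsmul, one_nsmul]

/-- The character `t ↦ χ (t • w)` of `ZMod |A|` ("`χ` evaluated along `w`"). [folklore] -/
def abEv (w : ι → A) (χ : AddChar (ι → A) ℂ) : AddChar (ZMod (Fintype.card A)) ℂ :=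
  χ.compAddMonoidHom (abCyc w)

/-- `abEv w χ t = χ (t.val • w)`. [folklore] -/
@[simp] theorem abEv_apply (w : ι → A) (χ : AddChar (ι → A) ℂ) (t : ZMod (Fintype.card A)) :
    abEv w χ t = χ (t.val • w) := rfl

/-- `abEv w χ 1 = χ w`. [folklore] -/
theorem abEv_one (w : ι → A) (χ : AddChar (ι → A) ℂ) : abEv w χ 1 = χ w := by
  rw [abEv, compAddMonoidHom_apply, abCyc_one]

end Cyc

/-! ## Coset CSPs over `A`: annihilators, generators, the Fredholm alternative -/

section CSP

variable {A : Type*} [AddCommGroup A] {nv m : ℕ} {r : Fin m → ℕ}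

/-- Restriction of an assignment `h : Fin nv → A` to a scope `sc : Fin k → Fin nv`, as a
homomorphism `A^{nv} →+ A^k`. [folklore] -/
def abProj {k : ℕ} (sc : Fin k → Fin nv) : (Fin nv → A) →+ (Fin k → A) where
  toFun h i := h (sc i)
  map_zero' := rfl
  map_add' _ _ := rfl

/-- `abProj sc h = h ∘ sc`. [folklore] -/
@[simp] theorem abProj_apply {k : ℕ} (sc : Fin k → Fin nv) (h : Fin nv → A) :
    abProj sc h = fun i => h (sc i) := rfl

/-- The **annihilator** of the subgroup `H j ≤ A^{r j}`: characters trivial on `H j`. [folklore] -/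
def abAnnih (H : (j : Fin m) → AddSubgroup (Fin (r j) → A)) (j : Fin m) :
    Set (AddChar (Fin (r j) → A) ℂ) :=
  {χ | ∀ k ∈ H j, χ k = 1}

/-- Membership in the annihilator. [folklore] -/
theorem mem_abAnnih {H : (j : Fin m) → AddSubgroup (Fin (r j) → A)} {j : Fin m}
    {χ : AddChar (Fin (r j) → A) ℂ} : χ ∈ abAnnih H j ↔ ∀ k ∈ H j, χ k = 1 := Iff.rfl

variable [Fintype A]

/-- The **generator** attached to constraint `j` and a character `χ` of `A^{r j}`: the pair
(pull-back of `χ` along the restriction to the scope of `j`, the character `t ↦ χ (t • c j)` of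
`ZMod |A|`). [folklore] -/
def abGen (scope : (j : Fin m) → Fin (r j) → Fin nv) (c : (j : Fin m) → Fin (r j) → A) (j : Fin m)
    (χ : AddChar (Fin (r j) → A) ℂ) :
    AddChar (Fin nv → A) ℂ × AddChar (ZMod (Fintype.card A)) ℂ :=
  (χ.compAddMonoidHom (abProj (scope j)), abEv (c j) χ)

/-- The generators of the SELECTED constraints (`v j = true`) with annihilating characters,
indexed by the pairs `⟨j, χ⟩`, `χ ∈ abAnnih H j`. [folklore] -/
def abGens (scope : (j : Fin m) → Fin (r j) → Fin nv)
    (H : (j : Fin m) → AddSubgroup (Fin (r j) → A)) (c : (j : Fin m) → Fin (r j) → A)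
    (v : Fin m → Bool) :
    Set (AddChar (Fin nv → A) ℂ × AddChar (ZMod (Fintype.card A)) ℂ) :=
  (fun p : Σ j, abAnnih H j => abGen scope c p.1 p.2) '' {p | v p.1 = true}

variable (scope : (j : Fin m) → Fin (r j) → Fin nv) (H : (j : Fin m) → AddSubgroup (Fin (r j) → A))
  (c : (j : Fin m) → Fin (r j) → A)

/-- `←` of the Fredholm alternative: along a common solution `h` of the selected constraints,
every `(θ, ω)` in the subgroup generated by the selected generators satisfies
`ω = (t ↦ θ (t • h))`; in particular `(0, ω)` forces `ω = 0`. [folklore] -/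
theorem ab_snd_eq_of_mem_closure {v : Fin m → Bool} {h : Fin nv → A}
    (hsol : ∀ j, v j = true → -c j + (fun i => h (scope j i)) ∈ H j)
    {q : AddChar (Fin nv → A) ℂ × AddChar (ZMod (Fintype.card A)) ℂ}
    (hq : q ∈ AddSubgroup.closure (abGens scope H c v)) :
    q.2 = q.1.compAddMonoidHom (abCyc h) := by
  induction hq using AddSubgroup.closure_induction with
  | mem q hq =>
    obtain ⟨⟨j, χ, hχ⟩, hj, rfl⟩ := hq
    ext t
    simp only [abGen, abEv_apply, compAddMonoidHom_apply, abCyc_apply, abProj_apply]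
    -- `h ∘ scope j = c j + k` with `k ∈ H j`
    have hk := hsol j hj
    set k : Fin (r j) → A := -c j + fun i => h (scope j i) with hk_def
    have hdec : (fun i => (t.val • h) (scope j i)) = t.val • c j + t.val • k := by
      rw [← nsmul_add, hk_def, add_neg_cancel_left]
      rfl
    rw [hdec, map_add_eq_mul, hχ _ (AddSubgroup.nsmul_mem _ hk _), mul_one]
  | zero => exact DFunLike.ext _ _ fun _ => rfl
  | add x y _ _ hx hy =>
    rw [Prod.snd_add, Prod.fst_add, hx, hy]
    exact DFunLike.ext _ _ fun _ => rfl
  | neg x _ hx =>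
    rw [Prod.snd_neg, Prod.fst_neg, hx]
    refine DFunLike.ext _ _ fun t => ?_
    simp only [AddChar.neg_apply, compAddMonoidHom_apply, map_neg]

/-- `abGen` vanishes on the trivial character. [folklore] -/
theorem abGen_zero (j : Fin m) : abGen scope c j 0 = 0 :=
  Prod.ext (DFunLike.ext _ _ fun _ => rfl) (DFunLike.ext _ _ fun _ => rfl)

/-- `→` of the Fredholm alternative: if the selected constraints have no common solution, then
for some `ω ≠ 0` the pair `(0, ω)` lies in the subgroup generated by the selected generators
(separate `(c j)_j` from `range Φ + ∏_{v j} H j` in `∏_j A^{r j}` by a character and sum its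
coordinate generators). [folklore] -/
theorem ab_exists_mem_closure_of_unsat {v : Fin m → Bool}
    (hun : ¬ ∃ h : Fin nv → A, ∀ j, v j = true → -c j + (fun i => h (scope j i)) ∈ H j) :
    ∃ ω : AddChar (ZMod (Fintype.card A)) ℂ, ω ≠ 0 ∧
      ((0 : AddChar (Fin nv → A) ℂ), ω) ∈ AddSubgroup.closure (abGens scope H c v) := by
  classical
  -- in the ambient product `∏_j A^{r j}`: the restriction map `Φ`, the box `HT = ∏_{v j} H j`
  set Φ : (Fin nv → A) →+ ((j : Fin m) → Fin (r j) → A) := AddMonoidHom.pi fun j => abProj (scope j)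
    with hΦ_def
  set HT : AddSubgroup ((j : Fin m) → Fin (r j) → A) := AddSubgroup.pi {j | v j = true} H
    with hHT_def
  have hΦ : ∀ h j, Φ h j = fun i => h (scope j i) := fun h j => by rw [hΦ_def]; rfl
  have hcK : (fun j => c j) ∉ Φ.range ⊔ HT := by
    intro hcK
    obtain ⟨y, hy, z, hz, hyz⟩ := AddSubgroup.mem_sup.1 hcK
    obtain ⟨h, rfl⟩ := AddMonoidHom.mem_range.1 hy
    refine hun ⟨h, fun j hj => ?_⟩
    have hzj : z j ∈ H j := by
      rw [hHT_def] at hz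
      exact (AddSubgroup.mem_pi _).1 hz j hj
    have hj' : Φ h j + z j = c j := congr_fun hyz j
    rw [← hΦ, ← hj', neg_add_rev, add_assoc, neg_add_cancel, add_zero]
    exact (H j).neg_mem hzj
  obtain ⟨Ψ, hΨK, hΨc⟩ := ab_exists_addChar_apply_ne_one _ hcK
  have hΨHT : ∀ w ∈ HT, Ψ w = 1 := fun w hw => hΨK w (AddSubgroup.mem_sup_right hw)
  have hΨΦ : ∀ h, Ψ (Φ h) = 1 := fun h => hΨK _ (AddSubgroup.mem_sup_left ⟨h, rfl⟩)
  -- the coordinate characters `χ j = Ψ ∘ single j`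
  set χ : (j : Fin m) → AddChar (Fin (r j) → A) ℂ := fun j =>
    Ψ.compAddMonoidHom (AddMonoidHom.single (fun j => Fin (r j) → A) j) with hχ_def
  have hχ : ∀ j u, χ j u = Ψ (Pi.single j u) := fun j u => by rw [hχ_def]; rfl
  have hsingle : ∀ j u, (v j = true → u ∈ H j) → Pi.single j u ∈ HT := fun j u hu => by
    rw [hHT_def]
    exact (AddSubgroup.single_mem_pi (I := {j | v j = true}) (H := H) j u).2 hu
  have hχ_on : ∀ j, v j = true → χ j ∈ abAnnih H j := fun j _ k hk =>
    (hχ j k).trans (hΨHT _ (hsingle j k fun _ => hk))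
  have hχ_off : ∀ j, v j = false → χ j = 0 := fun j hj =>
    DFunLike.ext _ _ fun u => (hχ j u).trans (hΨHT _ (hsingle j u fun hj' => by
      rw [hj] at hj'
      exact absurd hj' Bool.false_ne_true))
  -- the certificate `q = ∑_j abGen j (χ j)`
  set q : AddChar (Fin nv → A) ℂ × AddChar (ZMod (Fintype.card A)) ℂ :=
    ∑ j, abGen scope c j (χ j) with hq_def
  have hq_mem : q ∈ AddSubgroup.closure (abGens scope H c v) := by
    rw [hq_def]
    refine AddSubgroup.sum_mem _ fun j _ => ?_
    cases hvj : v j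
    · rw [hχ_off j hvj, abGen_zero]
      exact AddSubgroup.zero_mem _
    · exact AddSubgroup.subset_closure ⟨⟨j, χ j, hχ_on j hvj⟩, hvj, rfl⟩
  have hq1 : q.1 = 0 := by
    refine DFunLike.ext _ _ fun h => ?_
    rw [hq_def, Prod.fst_sum, AddChar.sum_apply, AddChar.zero_apply]
    simp only [abGen, compAddMonoidHom_apply, abProj_apply, hχ]
    rw [← ab_map_sum]
    have hsum :
        (∑ j, Pi.single j (fun i => h (scope j i)) : (j : Fin m) → Fin (r j) → A) = Φ h := by
      rw [← Finset.univ_sum_single (Φ h)]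
      simp only [hΦ]
    rw [hsum]
    exact hΨΦ h
  have hq2 : q.2 1 = Ψ (fun j => c j) := by
    rw [hq_def, Prod.snd_sum, AddChar.sum_apply]
    simp only [abGen, abEv_one, hχ]
    rw [← ab_map_sum, Finset.univ_sum_single]
  refine ⟨q.2, fun h0 => hΨc ?_, ?_⟩
  · rw [← hq2, h0, AddChar.zero_apply]
  · have hq : ((0 : AddChar (Fin nv → A) ℂ), q.2) = q := Prod.ext hq1.symm rfl
    rw [hq]
    exact hq_mem

end CSP

/-- **The abelian coset Fredholm alternative** ("meet-to-join").  For coset constraints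
`-c j + h ∘ scope j ∈ H j` (`H j ≤ A^{r j}`, `A` finite abelian) and a selection `v`, the selected
constraints have NO common solution iff for some nontrivial character `ω` of `ZMod |A|` the pair
`(0, ω)` lies in the subgroup of `Â^{nv} × (ZMod |A|)̂` generated by the selected generators
`abGen j χ = (χ ∘ scope j^*, t ↦ χ (t • c j))`, `v j = true`, `χ ∈ (H j)^⊥`. [folklore] -/
theorem abelianCosetFredholm : ∀ {A : Type*} [AddCommGroup A] [Fintype A] {nv m : ℕ}
    {r : Fin m → ℕ} (scope : (j : Fin m) → Fin (r j) → Fin nv)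
    (H : (j : Fin m) → AddSubgroup (Fin (r j) → A)) (c : (j : Fin m) → Fin (r j) → A)
    (v : Fin m → Bool),
    (¬ ∃ h : Fin nv → A, ∀ j, v j = true → -c j + (fun i => h (scope j i)) ∈ H j) ↔
      ∃ ω : AddChar (ZMod (Fintype.card A)) ℂ, ω ≠ 0 ∧
        ((0 : AddChar (Fin nv → A) ℂ), ω) ∈ AddSubgroup.closure (abGens scope H c v) := by
  intro A _ _ nv m r scope H c v
  refine ⟨ab_exists_mem_closure_of_unsat scope H c, ?_⟩
  rintro ⟨ω, hω, hmem⟩ ⟨h, hsol⟩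
  exact hω ((ab_snd_eq_of_mem_closure scope H c hsol hmem).trans (DFunLike.ext _ _ fun _ => rfl))

/-! ## The small faithful model and transport of generated subgroups -/

section Model

variable {A : Type*} [AddCommGroup A] [Fintype A]

/-- **Small faithful model**: record `(θ, ω) ∈ Â^{nv} × (ZMod |A|)̂` as the `Option (Fin nv)`-tuple
with entries `(θ ∘ single x, 0)` at `some x` and `(0, ω)` at `none` — a homomorphism into
`Option (Fin nv) → Â × (ZMod |A|)̂`, a group with `|A|² (nv + 1)` "coordinates × values".
[folklore] -/
def abEmb (nv : ℕ) : AddChar (Fin nv → A) ℂ × AddChar (ZMod (Fintype.card A)) ℂ →+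
    (Option (Fin nv) → AddChar A ℂ × AddChar (ZMod (Fintype.card A)) ℂ) where
  toFun q o :=
    o.elim (0, q.2) fun x => (q.1.compAddMonoidHom (AddMonoidHom.single (fun _ => A) x), 0)
  map_zero' := by
    funext o
    cases o with
    | none => rfl
    | some x => exact Prod.ext (DFunLike.ext _ _ fun _ => rfl) rfl
  map_add' q q' := by
    funext o
    cases o with
    | none => exact Prod.ext (zero_add _).symm rfl
    | some x => exact Prod.ext (DFunLike.ext _ _ fun _ => rfl) (zero_add _).symm

/-- `abEmb` at `none`. [folklore] -/
@[simp] theorem abEmb_apply_none (nv : ℕ)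
    (q : AddChar (Fin nv → A) ℂ × AddChar (ZMod (Fintype.card A)) ℂ) :
    abEmb nv q none = (0, q.2) := rfl

/-- `abEmb` at `some x`. [folklore] -/
@[simp] theorem abEmb_apply_some (nv : ℕ)
    (q : AddChar (Fin nv → A) ℂ × AddChar (ZMod (Fintype.card A)) ℂ) (x : Fin nv) :
    abEmb nv q (some x) = (q.1.compAddMonoidHom (AddMonoidHom.single (fun _ => A) x), 0) := rfl

/-- The small model is **faithful**: a character of `A^{nv}` is determined by its restrictions to
the `nv` coordinate copies of `A` (`h = ∑_x single x (h x)`). [folklore] -/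
theorem abEmb_injective (nv : ℕ) : Function.Injective (abEmb (A := A) nv) := by
  refine (injective_iff_map_eq_zero _).2 fun q hq => ?_
  have h2 : q.2 = 0 := by simpa using congr_arg Prod.snd (congr_fun hq none)
  have h1 : ∀ x, q.1.compAddMonoidHom (AddMonoidHom.single (fun _ => A) x) = 0 := fun x => by
    simpa using congr_arg Prod.fst (congr_fun hq (some x))
  refine Prod.ext (DFunLike.ext _ _ fun h => ?_) h2
  rw [Prod.fst_zero, AddChar.zero_apply, ← Finset.univ_sum_single h, ab_map_sum]
  exact Finset.prod_eq_one fun x _ => DFunLike.congr_fun (h1 x) (h x)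

/-- **Transport of generated subgroups** along an injective homomorphism-like map from an additive
to a multiplicative group: `φ q ∈ ⟨φ '' S⟩ ↔ q ∈ ⟨S⟩`. [folklore] -/
theorem ab_mem_closure_image_iff {Q M : Type*} [AddGroup Q] [Group M] (φ : Q → M) (h0 : φ 0 = 1)
    (hadd : ∀ a b, φ (a + b) = φ a * φ b) (hinj : Function.Injective φ) (S : Set Q) (q : Q) :
    φ q ∈ Subgroup.closure (φ '' S) ↔ q ∈ AddSubgroup.closure S := by
  have hneg : ∀ a, φ (-a) = (φ a)⁻¹ := fun a =>
    eq_inv_of_mul_eq_one_left (by rw [← hadd, neg_add_cancel, h0])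
  constructor
  · intro h
    suffices hS : ∀ g ∈ Subgroup.closure (φ '' S), ∃ u ∈ AddSubgroup.closure S, φ u = g by
      obtain ⟨u, hu, hug⟩ := hS _ h
      rwa [← hinj hug]
    intro g hg
    induction hg using Subgroup.closure_induction with
    | mem x hx =>
      obtain ⟨u, hu, rfl⟩ := hx
      exact ⟨u, AddSubgroup.subset_closure hu, rfl⟩
    | one => exact ⟨0, AddSubgroup.zero_mem _, h0⟩
    | mul x y _ _ ihx ihy =>
      obtain ⟨u, hu, rfl⟩ := ihx
      obtain ⟨u', hu', rfl⟩ := ihy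
      exact ⟨u + u', AddSubgroup.add_mem _ hu hu', hadd u u'⟩
    | inv x _ ih =>
      obtain ⟨u, hu, rfl⟩ := ih
      exact ⟨-u, AddSubgroup.neg_mem _ hu, hneg u⟩
  · intro h
    induction h using AddSubgroup.closure_induction with
    | mem x hx => exact Subgroup.subset_closure ⟨x, hx, rfl⟩
    | zero => rw [h0]; exact Subgroup.one_mem _
    | add x y _ _ ihx ihy => rw [hadd]; exact Subgroup.mul_mem _ ihx ihy
    | neg x _ ih => rw [hneg]; exact Subgroup.inv_mem _ ih

end Model

end Summit.PneNP.PneNP.Cruxes.Capture.CspSpineMeetToJoin
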